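import Summits.CriticalPhenomena.PercolationContinuityZ3.Theorems.PercNearOneGluingNoHeavyQuantLongTailHub
import HarnessLib

/-!
# QUANT lane R8, T-DEC: THE SUB-FLOOR HUB OF SHAPE `{lo, lo+K; γ}` FOR EVERY `lo < K ≤ 2lo`, NARROW PART — the hubs of widths 2 and 3,
# `S(γ₁) ∗ S(γ₂)` and `S(γ₁) ∗ S(γ₂) ∗ S(γ₃)`, are SDEC whenever `lo ≤ Kγᵢ`, `γᵢ < 1`, `x(lo+K) ≤ lo + Kγᵢ` (census-1 gen 32)

builds on p205010 (kernel theorem, internal audit signed; external expert review pending)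

Support file (`--supports stmt-CriticalPhenomena-4575`), QUANT lane seat prim-quant-census-1 (gen 32); memo
`run/shared/lean/prim/quant/prim-quant-census-1/g32/TWOLO-G32.md` §1.  Theorems only (no definitions), standard axioms, no sorries.  Uses
`sdec_of_nearRoutes_charged` (`…QuantNearRouteShape`), `sdec_farthestNear` (`…QuantFarthestNearRoute`), the binomial-extremality route bound
`sHub_routeBound_nearOne` (`…QuantBinomialExtremal`), `cap_of_ratio` / `le_sum_of_forall_le` / `sum_map_affine` (`…QuantLongTailHub`).  Widths `≥ 4` are
`sdec_sHub_wide` (`…QuantShapeHubWide`); the union over all widths and the forest theorem are `…QuantShapeForestTwoLo`.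

THE NARROW WIDTHS.  For `K ≤ 2lo` the hub of width `j` lives on `lo·j + K·s`; at widths 2 and 3 the only positive low is the bottom atom `lo·j` (a second
low `lo·j + K` would need `T > 2lo·j + 2K > T₀`), and its near absorber always exists: width 2 — the middle atom `2lo + K ≤ 4lo < T`, compatible since
`T₀ < 2lo + 2K ≤ 4lo + K`; width 3 — the farthest atom below `T` (`K < 3lo`, `sdec_farthestNear`).  The capacity `max(x, ρ)(u₀ + u_t) ≤ u_t` is
discharged by BINOMIAL EXTREMALITY at the MEAN gate `c̄ = Λ/j` (`Λ = Σγᵢ`; gates `≥ lo/K ≥ 1/2`): `u_t ≥ C(j,t)·ω̄^t·u₀`, `ω̄ = Λ/(j − Λ)`, so it is enough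
that `θ((j−Λ)^t + C(j,t)Λ^t) ≤ C(j,t)Λ^t` for `θ = x` and `θ = ρ` — four closed-form inequalities in `(Λ, lo/K)`:
width 2 (`t = 1`): `θ(2+Λ) ≤ 2Λ` ⟸ `x`: `2lo(2−Λ) ≤ KΛ(2−Λ)`; `ρ ≤ Λ − 2lo/K`: `KΛ² ≤ 2lo(Λ+2)` ⟸ `K ≤ 2lo`, `Λ ≤ 2`;
width 3, `t = 1` (`T ≤ 3lo + 2K`): `ρ ≤ (2K−3lo)/K ≤ 1/2`, `3ω̄ ≥ 3`; `x(3+2Λ) ≤ 3Λ` ⟸ `3lo(3−Λ) ≤ 2KΛ(3−Λ)`;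
width 3, `t = 2`: `θ((3−Λ)² + 3Λ²) ≤ 3Λ²` ⟸ `x`: `(3−Λ)[3lo(3−Λ) − KΛ(4Λ−3)] ≤ 0`; `ρ ≤ (Λ − 3lo/K)/2 ≤ (2Λ−3)/4`:
`(2Λ−3)(4Λ²−6Λ+9) − 12Λ² = 4Λ²(2Λ−9) + 36Λ − 27 ≤ −3(2Λ−3)² ≤ 0`.
* `cap_of_poly` (clearing the denominator `(j−Λ)^t`), `odds_mean_eq`;
* **`sdec_sHub_two`**, **`sdec_sHub_three`** — `lo < K ≤ 2lo`, `|P| = 2` / `3`, `lo ≤ Kγ`, `γ < 1`, `x(lo+K) ≤ lo + Kγ`, `0 < x` ⟹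
  `SDEC x ((lo+K)|P|) (sHub lo K P)`.
Numerics (memo §1, code/exp21.py, exact rationals): the 15 shapes `lo < K ≤ 2lo`, `lo ≤ 5`, widths 2, 3, 10-point asymmetric gate grids from `lo/K` to
`4095/4096`, 48 outer gates: 0 failures of the true-mass capacity, of its binomial-bound form, and of the four closed forms (61 000 rows).

HONEST STATUS.  A shape-general SDEC family of hubs (the cores of the forests of glued siblings `R^lo(R^K)`, `K ≤ 2lo` — `…QuantShapeForestTwoLo`);
`SiblingStep`, `GluedDominatedMass`, `SDECConvClosed`, `FarTreeRow` OPEN; RATE class (log\*) / honest sentence of `run/shared/lean/prim/quant/README.md`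
unchanged.  [this work].  Nothing here is cited as a published result.  The gluing rows served [cite: KozmaNitzan2024, Conjecture 3 (p. 15)]; product
measure [cite: Grimmett1999, §1.3 p. 10].
-/

noncomputable section

open scoped BigOperators

namespace Summit.CriticalPhenomena.PercolationContinuityZ3.Theorems
namespace Quant
namespace LawDec

open Finset

/-! ### Algebra of the mean-gate capacity -/

/-- clearing the denominator: `θ((j−Λ)^t + CΛ^t) ≤ CΛ^t`, `Λ < j` ⟹ `θ(1 + C(Λ/(j−Λ))^t) ≤ C(Λ/(j−Λ))^t`. [this work] -/
theorem cap_of_poly {θ Λ j C : ℝ} (t : ℕ) (hjΛ : Λ < j) (h : θ * ((j - Λ) ^ t + C * Λ ^ t) ≤ C * Λ ^ t) :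
    θ * (1 + C * (Λ / (j - Λ)) ^ t) ≤ C * (Λ / (j - Λ)) ^ t := by
  have hd : 0 < (j - Λ) ^ t := pow_pos (by linarith) t
  have hd' : (j - Λ) ^ t ≠ 0 := hd.ne'
  rw [div_pow]
  have e1 : 1 + C * (Λ ^ t / (j - Λ) ^ t) = ((j - Λ) ^ t + C * Λ ^ t) / (j - Λ) ^ t := by
    field_simp
  have e2 : C * (Λ ^ t / (j - Λ) ^ t) = (C * Λ ^ t) / (j - Λ) ^ t := by ring
  rw [e1, e2, ← mul_div_assoc, div_le_div_iff_of_pos_right hd]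
  exact h

/-- the odds of the mean gate: `(Λ/j)/(1 − Λ/j) = Λ/(j − Λ)` (`j ≠ 0`). [this work] -/
theorem odds_mean_eq {Λ j : ℝ} (hj : j ≠ 0) : Λ / j / (1 - Λ / j) = Λ / (j - Λ) := by
  rw [one_sub_div hj, div_div_div_cancel_right₀ hj]

/-- common facts of a far-giant gate list of shape `lo < K ≤ 2lo`: gates in `[1/2, 1)`, `K·Σγ ≥ lo·|P|`, `|P|·x(lo+K) ≤ lo·|P| + K·Σγ`.
[this work] -/
theorem twoLo_list_facts (lo K : ℕ) (hloK : lo < K) (hK2 : K ≤ 2 * lo) (x : ℝ) (P : List ℝ)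
    (hP : ∀ γ ∈ P, (lo : ℝ) ≤ K * γ ∧ γ < 1 ∧ x * ((lo : ℝ) + K) ≤ lo + K * γ) :
    (∀ γ ∈ P, 1 / 2 ≤ γ ∧ γ < 1) ∧ (lo : ℝ) * P.length ≤ K * P.sum ∧
      (P.length : ℝ) * (x * ((lo : ℝ) + K)) ≤ (lo : ℝ) * P.length + K * P.sum := by
  have hK : 0 < K := lt_of_le_of_lt (Nat.zero_le lo) hloK
  have hK0 : (0 : ℝ) < K := by exact_mod_cast hK
  have hK2R : (K : ℝ) ≤ 2 * lo := by exact_mod_cast hK2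
  refine ⟨fun γ hγ => ⟨?_, (hP γ hγ).2.1⟩, ?_, ?_⟩
  · by_contra h
    push Not at h
    have := mul_lt_mul_of_pos_left h hK0
    linarith [(hP γ hγ).1]
  · have hs := le_sum_of_forall_le ((lo : ℝ) / K) P (fun γ hγ => by rw [div_le_iff₀ hK0]; linarith [(hP γ hγ).1])
    rw [div_mul_eq_mul_div, div_le_iff₀ hK0] at hs
    linarith
  · have hs := le_sum_of_forall_le ((x * ((lo : ℝ) + K) - lo) / K) P (fun γ hγ => by
      rw [div_le_iff₀ hK0]; linarith [(hP γ hγ).2.2])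
    rw [div_mul_eq_mul_div, div_le_iff₀ hK0] at hs
    linarith

/-! ### Width 2 -/

/-- **THE HUB OF WIDTH 2, SHAPE `lo < K ≤ 2lo`, IS SDEC**: `S(γ₁) ∗ S(γ₂)` on `{2lo, 2lo+K, 2lo+2K}` with `lo ≤ Kγᵢ`, `γᵢ < 1`, `x(lo+K) ≤ lo + Kγᵢ`,
`0 < x` ⟹ `SDEC x (2(lo+K)) (sHub lo K [γ₁, γ₂])`.  The one positive low `2lo` (when `T > 4lo`) ships to the middle atom, NEAR and compatible; capacity
by the mean-gate binomial bound `u₁ ≥ 2ω̄·u₀`. [this work] -/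
theorem sdec_sHub_two (lo K : ℕ) (hloK : lo < K) (hK2 : K ≤ 2 * lo) {x : ℝ} (hx0 : 0 < x) (P : List ℝ) (hP2 : P.length = 2)
    (hP : ∀ γ ∈ P, (lo : ℝ) ≤ K * γ ∧ γ < 1 ∧ x * ((lo : ℝ) + K) ≤ lo + K * γ) :
    SDEC x ((lo + K) * P.length) (sHub lo K P) := by
  have hK : 0 < K := lt_of_le_of_lt (Nat.zero_le lo) hloK
  have hK0 : (0 : ℝ) < K := by exact_mod_cast hK
  have hlo0 : (0 : ℝ) ≤ lo := Nat.cast_nonneg lo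
  have hK2R : (K : ℝ) ≤ 2 * lo := by exact_mod_cast hK2
  have hPne : P ≠ [] := by intro h; rw [h] at hP2; simp at hP2
  have hj2R : (P.length : ℝ) = 2 := by exact_mod_cast hP2
  obtain ⟨hPh, hKΛ, hxT⟩ := twoLo_list_facts lo K hloK hK2 x P hP
  rw [hj2R] at hKΛ hxT
  have hP01 : ∀ γ ∈ P, 0 ≤ γ ∧ γ ≤ 1 := fun γ hγ => ⟨by linarith [(hPh γ hγ).1], (hPh γ hγ).2.le⟩
  obtain ⟨h0, hM, h1, hmean⟩ := sHub_laws lo K P hP01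
  rw [sum_map_affine] at hmean
  set Λ : ℝ := P.sum with hΛ
  have hΛ2 : Λ < 2 := by have := (sum_bounds_nearOne P hPh).2 hPne; rwa [hj2R] at this
  have hΛ1 : 1 ≤ Λ := by have := (sum_bounds_nearOne P hPh).1; rw [hj2R] at this; linarith
  -- `x < 1`, floor, positivity of the mean
  obtain ⟨γ₁, hγ₁⟩ := List.exists_mem_of_ne_nil P hPne
  have hx1 : x < 1 := by
    have h := (hP γ₁ hγ₁).2.2
    have hγ1 : (K : ℝ) * γ₁ < K * 1 := mul_lt_mul_of_pos_left (hP γ₁ hγ₁).2.1 hK0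
    by_contra hx
    push Not at hx
    have : 1 * ((lo : ℝ) + K) ≤ x * (lo + K) := mul_le_mul_of_nonneg_right hx (by linarith)
    linarith
  have hta : x * (((lo + K) * P.length : ℕ) : ℝ) ≤ (lo : ℝ) * P.length + K * Λ := by
    push_cast; rw [hj2R]; linarith
  have hT0pos : 0 < (lo : ℝ) * P.length + K * Λ := by
    rw [hj2R]; have : (0 : ℝ) < K * Λ := mul_pos hK0 (by linarith); linarith
  have hsupp : ∀ h, sHub lo K P h ≠ 0 → ∃ s, h = lo * P.length + K * s := by
    intro h hh
    obtain ⟨s, hs, _⟩ := (sHub_struct lo K hloK 0 le_rfl P (fun γ hγ => ⟨(hP01 γ hγ).1, (hP01 γ hγ).2, by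
      rw [zero_mul]; exact (hP01 γ hγ).1⟩)).1 h hh
    exact ⟨s, hs⟩
  refine sdec_of_nearRoutes_charged x ((lo : ℝ) * P.length + K * Λ) ((lo + K) * P.length) (sHub lo K P) (fun _ l => l + K)
    hx0 hx1 h0 hM h1 hmean hT0pos hta ?_ ?_
  · intro T hTpos hTle l _hl1 hlT hμl
    obtain ⟨s, hs⟩ := hsupp l hμl.ne'
    rw [hj2R] at hTle
    -- the charged low is the bottom atom
    have hs0 : s = 0 := by
      rcases Nat.eq_zero_or_pos s with h | h
      · exact h
      · exfalso
        have h1s : (1 : ℝ) ≤ s := by exact_mod_cast h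
        have hl : (l : ℝ) = lo * P.length + K * s := by rw [hs]; push_cast; ring
        rw [hj2R] at hl
        have hKs := mul_le_mul_of_nonneg_left h1s hK0.le
        have hKΛ2 := mul_lt_mul_of_pos_left hΛ2 hK0
        linarith
    subst hs0
    have hl : (l : ℝ) = 2 * lo := by rw [hs]; push_cast; rw [hj2R]; ring
    show l < l + K ∧ ((l + K : ℕ) : ℝ) < T ∧ T < (l : ℝ) + ((l + K : ℕ) : ℝ) ∧
      max x ((T - 2 * (l : ℝ)) / (((l + K : ℕ) : ℝ) - l)) * (sHub lo K P l + sHub lo K P (l + K)) ≤ sHub lo K P (l + K)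
    refine ⟨by omega, by push_cast; rw [hl]; linarith, by push_cast; rw [hl]; linarith [mul_lt_mul_of_pos_left hΛ2 hK0], ?_⟩
    have ed : (((l + K : ℕ) : ℝ) - l) = K := by push_cast; ring
    -- the route bound at the mean gate `c = Λ/2`
    set c : ℝ := Λ / 2 with hc
    have hc2 : 1 / 2 ≤ c := by rw [hc]; linarith
    have hc1 : c < 1 := by rw [hc]; linarith
    have hcs : c * (((P.length - 0 : ℕ)) : ℝ) ≤ P.sum - ((0 : ℕ) : ℝ) := by
      rw [Nat.sub_zero, hj2R, Nat.cast_zero, sub_zero, hc, ← hΛ]; linarith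
    have hRB := sHub_routeBound_nearOne lo K hloK P hPh 0 1 (by rw [hP2]; norm_num) c hc2 hc1 hcs
    rw [Nat.sub_zero, Nat.choose_one_right, Nat.choose_zero_right, pow_one, hc, odds_mean_eq two_ne_zero, Nat.mul_zero,
      Nat.add_zero, Nat.zero_add, Nat.cast_one, one_mul, hj2R] at hRB
    set u₀ : ℝ := sHub lo K P (lo * P.length) with hu₀
    set u₁ : ℝ := sHub lo K P (lo * P.length + K * 1) with hu₁
    have e0 : sHub lo K P l = u₀ := by rw [hu₀, hs, Nat.mul_zero, Nat.add_zero]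
    have e1 : sHub lo K P (l + K) = u₁ := by rw [hu₁, hs]; congr 1; ring
    rw [ed, hl, e0, e1]
    have hu0 : 0 ≤ u₀ := h0 _
    have hω0 : 0 ≤ Λ / (2 - Λ) := div_nonneg (by linarith) (by linarith)
    have hB0 : 0 ≤ 2 * (Λ / (2 - Λ)) := by linarith
    have hb : 2 * (Λ / (2 - Λ)) * u₀ ≤ u₁ := by rw [mul_comm]; exact hRB
    have e3 : (2 - Λ) ^ 1 + 2 * Λ ^ 1 = 2 + Λ := by ring
    -- the two closed forms
    have hx2 : x * ((2 - Λ) ^ 1 + 2 * Λ ^ 1) ≤ 2 * Λ ^ 1 := by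
      rw [e3, pow_one]
      have hB : (0 : ℝ) < 2 * ((lo : ℝ) + K) := by linarith
      have key : (2 * (lo : ℝ) + K * Λ) * (2 + Λ) ≤ 4 * Λ * ((lo : ℝ) + K) := by
        linarith [mul_nonneg (sub_nonneg.2 hΛ2.le) (sub_nonneg.2 hKΛ)]
      have h3 : x * (2 + Λ) * (2 * ((lo : ℝ) + K)) ≤ (2 * (lo : ℝ) + K * Λ) * (2 + Λ) := by
        have h := mul_le_mul_of_nonneg_right hxT (by linarith : (0 : ℝ) ≤ 2 + Λ)
        linarith
      have h4 : x * (2 + Λ) * (2 * ((lo : ℝ) + K)) ≤ 2 * Λ * (2 * ((lo : ℝ) + K)) := by linarith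
      exact le_of_mul_le_mul_right h4 hB
    have hρ2 : (T - 2 * (2 * (lo : ℝ))) / K * ((2 - Λ) ^ 1 + 2 * Λ ^ 1) ≤ 2 * Λ ^ 1 := by
      rw [e3, pow_one, div_mul_eq_mul_div, div_le_iff₀ hK0]
      have hD : T - 2 * (2 * (lo : ℝ)) ≤ K * Λ - 2 * lo := by linarith
      have h5 : (T - 2 * (2 * (lo : ℝ))) * (2 + Λ) ≤ (K * Λ - 2 * lo) * (2 + Λ) :=
        mul_le_mul_of_nonneg_right hD (by linarith)
      have hΛsq : Λ ^ 2 ≤ Λ + 2 := by linarith [mul_nonneg (sub_nonneg.2 hΛ2.le) (by linarith : (0 : ℝ) ≤ Λ + 1)]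
      have h6 : (K : ℝ) * Λ ^ 2 ≤ 2 * lo * (Λ + 2) :=
        calc (K : ℝ) * Λ ^ 2 ≤ 2 * lo * Λ ^ 2 := mul_le_mul_of_nonneg_right hK2R (sq_nonneg Λ)
          _ ≤ 2 * lo * (Λ + 2) := mul_le_mul_of_nonneg_left hΛsq (by linarith)
      have e4 : ((K : ℝ) * Λ - 2 * lo) * (2 + Λ) = 2 * Λ * K + (K * Λ ^ 2 - 2 * lo * (Λ + 2)) := by ring
      linarith [h5, h6, e4]
    have hxB := cap_of_poly (C := 2) (j := 2) 1 hΛ2 hx2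
    have hρB := cap_of_poly (C := 2) (j := 2) 1 hΛ2 hρ2
    simp only [pow_one] at hxB hρB
    rw [max_mul_of_nonneg _ _ (add_nonneg hu0 (h0 _))]
    exact max_le (cap_of_ratio hB0 hxB hu0 hb) (cap_of_ratio hB0 hρB hu0 hb)
  · intro T _ _ l l' _ _ _ _ _ _ heq
    exact Nat.add_right_cancel heq

/-! ### Width 3 -/

/-- **THE HUB OF WIDTH 3, SHAPE `lo < K ≤ 2lo`, IS SDEC**: `S(γ₁) ∗ S(γ₂) ∗ S(γ₃)` on `{3lo + Ks}` with `lo ≤ Kγᵢ`, `γᵢ < 1`, `x(lo+K) ≤ lo + Kγᵢ`,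
`0 < x` ⟹ `SDEC x (3(lo+K)) (sHub lo K [γ₁, γ₂, γ₃])`.  The one positive low `3lo` (when `T > 6lo`) ships to the farthest atom below `T` (`K < 3lo`:
`sdec_farthestNear`); capacity by the mean-gate binomial bounds `u₁ ≥ 3ω̄·u₀`, `u₂ ≥ 3ω̄²·u₀`. [this work] -/
theorem sdec_sHub_three (lo K : ℕ) (hloK : lo < K) (hK2 : K ≤ 2 * lo) {x : ℝ} (hx0 : 0 < x) (P : List ℝ) (hP3 : P.length = 3)
    (hP : ∀ γ ∈ P, (lo : ℝ) ≤ K * γ ∧ γ < 1 ∧ x * ((lo : ℝ) + K) ≤ lo + K * γ) :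
    SDEC x ((lo + K) * P.length) (sHub lo K P) := by
  have hK : 0 < K := lt_of_le_of_lt (Nat.zero_le lo) hloK
  have hjK : K < lo * P.length := by rw [hP3]; omega
  have hK0 : (0 : ℝ) < K := by exact_mod_cast hK
  have hlo0 : (0 : ℝ) ≤ lo := Nat.cast_nonneg lo
  have hK2R : (K : ℝ) ≤ 2 * lo := by exact_mod_cast hK2
  have hPne : P ≠ [] := by intro h; rw [h] at hP3; simp at hP3
  have hj3R : (P.length : ℝ) = 3 := by exact_mod_cast hP3
  obtain ⟨hPh, hKΛ, hxT⟩ := twoLo_list_facts lo K hloK hK2 x P hP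
  rw [hj3R] at hKΛ hxT
  have hP01 : ∀ γ ∈ P, 0 ≤ γ ∧ γ ≤ 1 := fun γ hγ => ⟨by linarith [(hPh γ hγ).1], (hPh γ hγ).2.le⟩
  obtain ⟨h0, hM, h1, hmean⟩ := sHub_laws lo K P hP01
  rw [sum_map_affine] at hmean
  set Λ : ℝ := P.sum with hΛ
  have hΛ3 : Λ < 3 := by have := (sum_bounds_nearOne P hPh).2 hPne; rwa [hj3R] at this
  have hΛ32 : 3 / 2 ≤ Λ := by have := (sum_bounds_nearOne P hPh).1; rw [hj3R] at this; linarith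
  obtain ⟨γ₁, hγ₁⟩ := List.exists_mem_of_ne_nil P hPne
  have hx1 : x < 1 := by
    have h := (hP γ₁ hγ₁).2.2
    have hγ1 : (K : ℝ) * γ₁ < K * 1 := mul_lt_mul_of_pos_left (hP γ₁ hγ₁).2.1 hK0
    by_contra hx
    push Not at hx
    have : 1 * ((lo : ℝ) + K) ≤ x * (lo + K) := mul_le_mul_of_nonneg_right hx (by linarith)
    linarith
  have hta : x * (((lo + K) * P.length : ℕ) : ℝ) ≤ (lo : ℝ) * P.length + K * Λ := by
    push_cast; rw [hj3R]; linarith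
  have hT0pos : 0 < (lo : ℝ) * P.length + K * Λ := by
    rw [hj3R]; have : (0 : ℝ) < K * Λ := mul_pos hK0 (by linarith); linarith
  have hsupp : ∀ h, sHub lo K P h ≠ 0 → ∃ s, h = lo * P.length + K * s := by
    intro h hh
    obtain ⟨s, hs, _⟩ := (sHub_struct lo K hloK 0 le_rfl P (fun γ hγ => ⟨(hP01 γ hγ).1, (hP01 γ hγ).2, by
      rw [zero_mul]; exact (hP01 γ hγ).1⟩)).1 h hh
    exact ⟨s, hs⟩
  refine sdec_farthestNear lo K P.length x ((lo : ℝ) * P.length + K * Λ) (sHub lo K P) hK hjK hx0 hx1 h0 hM h1 hmean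
    hT0pos hta hsupp ?_
  intro T hTpos hTle t s hKt hTc h2s hlT _hμl
  rw [hj3R] at hKt hTc hlT hTle
  -- `t ≤ 2` and the charged low is the bottom atom
  have ht2 : t ≤ 2 := by
    have : (K : ℝ) * t < K * 3 := by linarith [mul_lt_mul_of_pos_left hΛ3 hK0]
    have : (t : ℝ) < 3 := lt_of_mul_lt_mul_left this hK0.le
    have : t < 3 := by exact_mod_cast this
    omega
  have hs0 : s = 0 := by
    rcases Nat.eq_zero_or_pos s with h | h
    · exact h
    · exfalso
      have h1s : (1 : ℝ) ≤ s := by exact_mod_cast h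
      have hKs := mul_le_mul_of_nonneg_left h1s hK0.le
      have hKΛ3 := mul_lt_mul_of_pos_left hΛ3 hK0
      linarith
  subst hs0
  have ht1 : 1 ≤ t := by omega
  rw [Nat.cast_zero, mul_zero, add_zero] at hlT
  rw [hj3R]
  simp only [Nat.sub_zero, Nat.cast_zero, mul_zero, add_zero]
  -- the route bound at the mean gate `c = Λ/3`
  set c : ℝ := Λ / 3 with hc
  have hc2 : 1 / 2 ≤ c := by rw [hc]; linarith
  have hc1 : c < 1 := by rw [hc]; linarith
  have hcs : c * (((P.length - 0 : ℕ)) : ℝ) ≤ P.sum - ((0 : ℕ) : ℝ) := by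
    rw [Nat.sub_zero, hj3R, Nat.cast_zero, sub_zero, hc, ← hΛ]; linarith
  have hRB := sHub_routeBound_nearOne lo K hloK P hPh 0 t (by rw [hP3]; norm_num) c hc2 hc1 hcs
  rw [Nat.sub_zero, Nat.choose_zero_right, hc, odds_mean_eq three_ne_zero, Nat.mul_zero, Nat.add_zero, Nat.zero_add,
    Nat.cast_one, one_mul] at hRB
  set u₀ : ℝ := sHub lo K P (lo * P.length) with hu₀
  set uₜ : ℝ := sHub lo K P (lo * P.length + K * t) with huₜ
  have hu0 : 0 ≤ u₀ := h0 _
  have hω0 : 0 ≤ Λ / (3 - Λ) := div_nonneg (by linarith) (by linarith)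
  have hB0 : 0 ≤ ((P.length.choose t : ℕ) : ℝ) * (Λ / (3 - Λ)) ^ t := mul_nonneg (Nat.cast_nonneg _) (pow_nonneg hω0 t)
  have hb : ((P.length.choose t : ℕ) : ℝ) * (Λ / (3 - Λ)) ^ t * u₀ ≤ uₜ := by rw [mul_comm]; exact hRB
  have hDpos : 0 < T - 2 * ((lo : ℝ) * 3) := by linarith
  have hc31 : P.length.choose 1 = 3 := by rw [hP3]; rfl
  have hc32 : P.length.choose 2 = 3 := by rw [hP3]; rfl
  have hB : (0 : ℝ) < 3 * ((lo : ℝ) + K) := by linarith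
  rw [max_mul_of_nonneg _ _ (add_nonneg hu0 (h0 _))]
  refine max_le (cap_of_ratio hB0 (cap_of_poly t hΛ3 ?_) hu0 hb) (cap_of_ratio hB0 (cap_of_poly t hΛ3 ?_) hu0 hb)
  · -- floor part
    interval_cases t
    · rw [hc31]; push_cast
      have e3 : (3 - Λ) ^ 1 + 3 * Λ ^ 1 = 3 + 2 * Λ := by ring
      rw [e3, pow_one]
      have key : (3 * (lo : ℝ) + K * Λ) * (3 + 2 * Λ) ≤ 9 * Λ * ((lo : ℝ) + K) := by
        linarith [mul_nonneg (sub_nonneg.2 hΛ3.le) (by linarith : (0 : ℝ) ≤ 2 * (K * Λ) - 3 * lo)]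
      have h3 : x * (3 + 2 * Λ) * (3 * ((lo : ℝ) + K)) ≤ (3 * (lo : ℝ) + K * Λ) * (3 + 2 * Λ) := by
        have h := mul_le_mul_of_nonneg_right hxT (by linarith : (0 : ℝ) ≤ 3 + 2 * Λ)
        linarith
      have h4 : x * (3 + 2 * Λ) * (3 * ((lo : ℝ) + K)) ≤ 3 * Λ * (3 * ((lo : ℝ) + K)) := by linarith
      exact le_of_mul_le_mul_right h4 hB
    · rw [hc32]; push_cast
      -- `(3lo + KΛ)((3−Λ)² + 3Λ²) ≤ 9Λ²(lo+K)` ⟸ `(3−Λ)·[3lo(3−Λ) − KΛ(4Λ−3)] ≤ 0`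
      have hin : 3 * (lo : ℝ) * (3 - Λ) ≤ K * Λ * (4 * Λ - 3) := by
        have h1 : 3 * (lo : ℝ) * (3 - Λ) ≤ 3 * lo * (4 * Λ - 3) := mul_le_mul_of_nonneg_left (by linarith) (by linarith)
        have h2 : 3 * (lo : ℝ) * (4 * Λ - 3) ≤ K * Λ * (4 * Λ - 3) := mul_le_mul_of_nonneg_right (by linarith) (by linarith)
        linarith
      have hq : 0 ≤ (3 - Λ) ^ 2 + 3 * Λ ^ 2 := by positivity
      have key : (3 * (lo : ℝ) + K * Λ) * ((3 - Λ) ^ 2 + 3 * Λ ^ 2) ≤ 9 * Λ ^ 2 * ((lo : ℝ) + K) := by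
        linarith [mul_nonneg (sub_nonneg.2 hΛ3.le) (sub_nonneg.2 hin)]
      have h3 : x * ((3 - Λ) ^ 2 + 3 * Λ ^ 2) * (3 * ((lo : ℝ) + K)) ≤ (3 * (lo : ℝ) + K * Λ) * ((3 - Λ) ^ 2 + 3 * Λ ^ 2) := by
        have h := mul_le_mul_of_nonneg_right hxT hq
        linarith
      have h4 : x * ((3 - Λ) ^ 2 + 3 * Λ ^ 2) * (3 * ((lo : ℝ) + K)) ≤ 3 * Λ ^ 2 * (3 * ((lo : ℝ) + K)) := by linarith
      exact le_of_mul_le_mul_right h4 hB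
  · -- credit part
    interval_cases t
    · rw [hc31]; push_cast
      have e3 : (3 - Λ) ^ 1 + 3 * Λ ^ 1 = 3 + 2 * Λ := by ring
      rw [e3, pow_one, mul_one, div_mul_eq_mul_div, div_le_iff₀ hK0]
      -- `T ≤ 3lo + 2K` ⟹ `T − 6lo ≤ 2K − 3lo ≤ K/2`; `Λ ≥ 3/2`
      push_cast at hTc
      have hD : T - 2 * ((lo : ℝ) * 3) ≤ K / 2 := by linarith
      have h5 : (T - 2 * ((lo : ℝ) * 3)) * (3 + 2 * Λ) ≤ K / 2 * (3 + 2 * Λ) := mul_le_mul_of_nonneg_right hD (by linarith)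
      have h6 : (K : ℝ) * (3 / 4) ≤ K * Λ := mul_le_mul_of_nonneg_left (by linarith) hK0.le
      linarith
    · rw [hc32]; push_cast
      rw [div_mul_eq_mul_div, div_le_iff₀ (by positivity : (0 : ℝ) < K * 2)]
      have hD' : T - 2 * ((lo : ℝ) * 3) ≤ K * (Λ - 3 / 2) := by linarith
      have hq : 0 < (3 - Λ) ^ 2 + 3 * Λ ^ 2 := by positivity
      have h5 : (T - 2 * ((lo : ℝ) * 3)) * ((3 - Λ) ^ 2 + 3 * Λ ^ 2) ≤ K * (Λ - 3 / 2) * ((3 - Λ) ^ 2 + 3 * Λ ^ 2) :=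
        mul_le_mul_of_nonneg_right hD' hq.le
      -- `6Λ² − (Λ − 3/2)((3−Λ)² + 3Λ²) = 4Λ²(3−Λ) + (3/2)(2Λ−3)² ≥ 0`
      have hpoly : (Λ - 3 / 2) * ((3 - Λ) ^ 2 + 3 * Λ ^ 2) ≤ 6 * Λ ^ 2 := by
        linarith [mul_nonneg (sq_nonneg Λ) (sub_nonneg.2 hΛ3.le), sq_nonneg (2 * Λ - 3)]
      have h7 : (K : ℝ) * ((Λ - 3 / 2) * ((3 - Λ) ^ 2 + 3 * Λ ^ 2)) ≤ K * (6 * Λ ^ 2) := mul_le_mul_of_nonneg_left hpoly hK0.le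
      have e' : (K : ℝ) * (Λ - 3 / 2) * ((3 - Λ) ^ 2 + 3 * Λ ^ 2) = K * ((Λ - 3 / 2) * ((3 - Λ) ^ 2 + 3 * Λ ^ 2)) := by ring
      linarith [h5, h7, e']

end LawDec
end Quant
end Summit.CriticalPhenomena.PercolationContinuityZ3.Theorems
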